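/-
Copyright (c) 2026 the pub-hodgecm-mathlib formalisation cell (harness21).  Prover seat hodgecm-mathlib-K2Liu-p11 (g6), Track B «K2-LIT»,
#184♮ = hLiu418 = `stmt-HodgeConjecture-24832`; socket #41, KIND 1, package (K1b-♮), letter (dec-2-pay): THE ASSEMBLER OF THE (β) BLOCK LETTER `hBL₁` OF
★ p864699 `K2LiuKindOneLineDecayOneFrameRate.hdecF₀_of_blockLetter_rate` (LEAD F0P6-plan (g16) BATCH #270 (2), K1b desk K2Liu-p14 (g5) DESK WORD #14 (3)).
THEOREMS ONLY (no `def`, no `instance`, no notation, no named-fact hypothesis, no `sorry`, default heartbeats).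
-/
import Summits.HodgeConjecture.HodgeConjecture.Theorems.K2LiuKindOneLineDecayOneFrameRate          -- ★ p864699 (K2Liu-p14 (g5)): the CONSUMER `hdecF₀_of_blockLetter_rate` — its `hBL₁` binder is this file's conclusion
import Summits.HodgeConjecture.HodgeConjecture.Theorems.K2LiuKindOneLineCornerArchFactorBounded    -- ★ p864675 (β-3) (LH4-p09 (g11)): `norm_corner_lineWhittaker_le_of_boundedMovers`
import HarnessLib

/-!
# Crux `HLiu418`, socket #41, KIND 1 — (dec-2-pay) `K2LiuKindOneLineBlockLetterOfRecord`: THE (β) BLOCK LETTER `hBL₁` FROM THE LINE'S EXPLICIT CHAIN, THE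
# ARCHIMEDEAN PER-PLACE FACTOR BY NAME, AND THE FINITE-HALF LETTER

Cell `hodgecm-mathlib`, crux item hLiu418 = `stmt-HodgeConjecture-24832` (helper lane `--supports … --as helper`, count-neutral), route of record
`HCCMUnconditional`; squad K2 ∕ K2Liu, road `K2_Liu`, socket #41, KIND 1, package (K1b-♮).  After ★ p864699 (the one-frame assembly at a payer-chosen rate) the K1-b♮
residue at the tie is the block letter `hBL₁` (★ p864699 :182–:207; twin `hBL₀` of ★ p864745): for the `B`-line frame, near every `z` with `0 < re z`, a bound of the rank-one
line Whittaker value of the translated corner family `y ↦ f_s(blkD(1,y)·Λ₀γ̂·h)` by `C·H(h)^a·D^{a₂}·(1+‖ι_∞S‖)^{N₀}` times, per complex place `σ`, the Gaussian factor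
`ρ_σ^{e₁ s}·‖det(σ(γ̂)A_σ)‖^{e₂ s}·(1+|σf|_σ ρ_σ)^{Ng}·e^{−cπ|σf|_σ ρ_σ}`, `ρ_σ = Σ_k‖(σ(γ̂)·A_σ)_{1k}‖²`, for EVERY Iwasawa block decomposition
`T_σ·(h_∞)_σ·T_σ⁻¹ = [A_σ, b_σ; 0, d_σ]·κ_σ` with `M`-bounded movers.  THIS FILE is the n := 1 twin of ★ p864379 `K2LiuKindWArchBlockLetterOfPlaceGrowth.hBL_of_placeGrowth`:
it ASSEMBLES `hBL₁` — conclusion = ★ p864699's binder TYPE VERBATIM, for generic frames `(Sinf, wp, hwp, hc, er, T, Tinv, M)` (so the tie's keying `T := T′`, the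
Levi-ADAPTED frames of ★ `K2LiuKindOneLineLeviFrameDictionary` §3, is an instance) — from:
* the ARCHIMEDEAN HALF BY NAME: ★ p864675 `norm_corner_lineWhittaker_le_of_boundedMovers` (per `σ`, at `Y := σ(γ̂)·A_σ`, movers `κ_σ κ′_σ`, rate `π∕(64M²)`), fed by
  the per-`(i,σ)` archimedean letters of a tensor presentation of the section family read in the tube frames — `hsec` (`IsArchSiegelSection` + scalar `K`-type) and
  `hline` (the rank-one line letter, ★ (KW1-d) `K2LiuKindOneLineWhittakerDecay` §1's shape) — and by the frames' letters `hTU` (the frames carry `U(H_σ)` into `U(J)`,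
  ★ `exists_tubeFrame_arch₄` (iii)) and `hLev` (the LEVI LETTER: `T_σ·(Λ₀γ)_σ·T_σ⁻¹ = diag(σ(γ), G′)` — conjuncts (7) `hTubeF` ∕ (6) `hLevi` of ★ p864905 `K2LiuKindOneLineLeviFramesOfRecord.exists_leviFrames_of_record`, LH4-p14 (g8));
* TWO NAMED RESIDUAL LETTERS, hypothesis-first: `hchain₁` — THE LINE'S EXPLICIT CHAIN (the n := 1 analogue of ★ p864207's `hchain`): on `{0 < re s}` the left side of
  `hBL₁` is at most `Σ_{i<m} ‖Ffin i σf (Λ₀γ̂·h) s‖ · ∏_σ ‖∫_ℝ Finf i σ s (ι(J₁·n₁(t)) · T_σ(Λ₀γ̂·h)_σT_σ⁻¹) e(−μ_σ t) dt‖` with `|μ_σ| = λ·|σf|_σ` (corner-index service ★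
  `K2LiuKindOneLineCornerIndexService`, place split ★ (KW1-b) `whittakerDelta_eq_kindWPart_mul_line` at `s′ = s + ½`, ★ `KindWPartFubini`, ★ (KW1-e)(e3) `isFactorizableOff_cornerTranslate`,
  ★ (KW1-e∞) `K2LiuKindOneLineCornerArchReading` — payer's road); and `hFfin` — THE FINITE HALF: `‖Ffin i σf (Λ₀γ̂·h) s‖ ≤ Cf·H(h)^{af}·D^{a₂}·(1+‖ι_∞S‖)^{N₀}` near `z`
  (benign at n := 1: on the window the line's local Whittaker integrals sit at `2 re s′ > 1` and converge absolutely).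
* §1 `one_add_mul_le`, `perPlace_repack` (the per-place constant at a payer-chosen rate `cπ := λπ∕(64M²)`, exponents `e₁ s := −(2re s+1)`, `e₂ s := 2re s+2` with ball
  bounds `κ₁ := |2re z+1|+2r`, `κ₂ := |2re z+2|+2r`, `Ng := 1`), `sum_mul_prod_le` (bookkeeping); §2 `frame_conj_mul` (the frame reading is multiplicative),
  `fromBlocks_diag_mul_blockUpper_mul`; §3 the head **`blockLetter_rate_of_record`**.
HONEST LABEL.  Count-neutral helper, hypothesis-first in `hTU hLev hsec hline hchain₁ hFfin` (payers: the frame package ∕ ★ LeviFrameDictionary for `hTU hLev`; the (KW-fac)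
arch letters for `hsec hline`; the line's explicit chain (F2) for `hchain₁`; the finite half (F3) for `hFfin`); it closes no socket: `HC_CM` is proved only modulo the 7 printed
citations (2 remaining named inputs: hLiu418 = `stmt-HodgeConjecture-24832`, h413 = `stmt-HodgeConjecture-24833`) until rung 0 closes.

## References
* [KudlaRallis1994] S. Kudla, S. Rallis, *A regularized Siegel–Weil formula: the first term identity*, Ann. of Math. 140 (1994): §2 (2.10)–(2.12).
* [MoeglinWaldspurger1995] C. Mœglin, J.-L. Waldspurger, *Spectral decomposition and Eisenstein series* (1995): I.2.2, II.1.7, IV.1.9.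
* [Shimura1997] G. Shimura, *Euler Products and Eisenstein Series*, CBMS 93 (1997): §16, §18.4 Prop. 18.14.
* [BorelJacquet1979] A. Borel, H. Jacquet, PSPM 33.1 (1979): §1.2, §4.1.
-/

set_option autoImplicit false
set_option linter.dupNamespace false -- the mandated namespace repeats `HodgeConjecture.HodgeConjecture`

noncomputable section

open scoped Matrix ENNReal NNReal ComplexConjugate BigOperators
open scoped Classical
open NumberField NumberField.InfinitePlace IsDedekindDomain MeasureTheory MeasureTheory.Measure Complex
open Literature.NumberTheory.Automorphic Literature.NumberTheory.Automorphic.UnitaryGroup Literature.NumberTheory.GaloisRepresentations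
open Literature.NumberTheory.GelbartRogawski1991 Literature.NumberTheory.GelbartRogawski1991.GRConstruction
open Literature.NumberTheory.GelbartRogawski1991.AdaptedBlocks
open Literature.NumberTheory.K2Lit.SiegelDoubled Literature.MeasureTheory.Group
open Literature.NumberTheory.ModularForms.SiegelUpperHalfSpace (moeb)
open UnitaryDualPair

namespace Summit.HodgeConjecture.HodgeConjecture.Cruxes.HLiu418.K2LiuKindOneLineBlockLetterOfRecord

open K2LiuSiegelUnipotentFourierDefs K2LiuSiegelUnipotentCharacters K2LiuUnipotentCoveringWeight K2LiuSiegelFourierCoeffDelta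
open K2LiuSiegelRationalLeviDecomposition K2LiuSiegelMiddleCellSortedPattern K2LiuSiegelMiddleCellLeviCriterion K2LiuSiegelBruhatMiddleCellDelta
open K2LiuArchInducedTubeDefs (IsArchSiegelSection)
open K2LiuKindOneLineCornerArchFactorBounded (norm_corner_lineWhittaker_le_of_boundedMovers)

/-! ## §1 Real bookkeeping: the per-place constant at a payer-chosen rate, and the sum-product bound -/

/-- `1 + λx ≤ max(1,λ)·(1 + x)` for `x ≥ 0`. [folklore] -/
theorem one_add_mul_le (lam : ℝ) {x : ℝ} (hx : 0 ≤ x) : 1 + lam * x ≤ max 1 lam * (1 + x) := by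
  have h1 : (1 : ℝ) ≤ max 1 lam := le_max_left _ _
  have h2 : lam * x ≤ max 1 lam * x := mul_le_mul_of_nonneg_right (le_max_right _ _) hx
  nlinarith

/-- **THE PER-PLACE CONSTANT AT A PAYER-CHOSEN RATE.**  ★ p864675's per-place bound
`E ≤ C_L·B₁^{|2σ+1|+1}·B₂^{|2σ+2|}·(ρ^{−(2σ+1)}·δ^{2σ+2}·((1+λxρ)·e^{−c·λxρ}))` (`B₁ = 64M²`, `B₂ = 32M²`, `|μ| = λx`) is repacked on the ball
`|2σ+1| ≤ κ₁`, `|2σ+2| ≤ κ₂` as `E ≤ (C_L·B₁^{κ₁+1}·B₂^{κ₂}·max(1,λ)) · (ρ^{−(2σ+1)}·δ^{2σ+2}·((1+xρ)^1·e^{−(cλ)·xρ}))` — the shape of ★ p864699's `hBL₁` factor with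
`Ng := 1`, `cπ := cλ`. [cite: MoeglinWaldspurger1995, II.1.7] [cite: Shimura1997, §18.4 Prop. 18.14] -/
theorem perPlace_repack {E CL B₁ B₂ ρ dt x lam c sre κ₁ κ₂ : ℝ} (hCL : 0 ≤ CL) (hB₁ : 1 ≤ B₁) (hB₂ : 1 ≤ B₂) (hρ : 0 ≤ ρ)
    (hdt : 0 ≤ dt) (hx : 0 ≤ x) (hlam : 0 < lam) (hκ₁ : |2 * sre + 1| ≤ κ₁) (hκ₂ : |2 * sre + 2| ≤ κ₂)
    (hE : E ≤ CL * B₁ ^ (|2 * sre + 1| + 1) * B₂ ^ |2 * sre + 2| *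
      (ρ ^ (-(2 * sre + 1)) * dt ^ (2 * sre + 2) * ((1 + lam * x * ρ) * Real.exp (-(c * (lam * x * ρ)))))) :
    E ≤ CL * B₁ ^ (κ₁ + 1) * B₂ ^ κ₂ * max 1 lam *
      (ρ ^ (-(2 * sre + 1)) * dt ^ (2 * sre + 2) * ((1 + x * ρ) ^ (1 : ℝ) * Real.exp (-(c * lam * (x * ρ))))) := by
  have hB₁0 : 0 ≤ B₁ := zero_le_one.trans hB₁
  have hB₂0 : 0 ≤ B₂ := zero_le_one.trans hB₂
  have h1 : B₁ ^ (|2 * sre + 1| + 1) ≤ B₁ ^ (κ₁ + 1) := Real.rpow_le_rpow_of_exponent_le hB₁ (by linarith)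
  have h2 : B₂ ^ |2 * sre + 2| ≤ B₂ ^ κ₂ := Real.rpow_le_rpow_of_exponent_le hB₂ hκ₂
  have hQ0 : 0 ≤ ρ ^ (-(2 * sre + 1)) * dt ^ (2 * sre + 2) := mul_nonneg (Real.rpow_nonneg hρ _) (Real.rpow_nonneg hdt _)
  have hxρ : 0 ≤ x * ρ := mul_nonneg hx hρ
  have hlxρ : 0 ≤ lam * x * ρ := mul_nonneg (mul_nonneg hlam.le hx) hρ
  have hg0 : 0 ≤ (1 + lam * x * ρ) * Real.exp (-(c * (lam * x * ρ))) := mul_nonneg (by linarith) (Real.exp_pos _).le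
  have hg : (1 + lam * x * ρ) * Real.exp (-(c * (lam * x * ρ))) ≤ max 1 lam * ((1 + x * ρ) ^ (1 : ℝ) * Real.exp (-(c * lam * (x * ρ)))) := by
    rw [Real.rpow_one, show c * lam * (x * ρ) = c * (lam * x * ρ) by ring, ← mul_assoc (max 1 lam)]
    refine mul_le_mul_of_nonneg_right ?_ (Real.exp_pos _).le
    rw [show lam * x * ρ = lam * (x * ρ) by ring]
    exact one_add_mul_le lam hxρ
  have hK0 : 0 ≤ CL * B₁ ^ (κ₁ + 1) * B₂ ^ κ₂ :=
    mul_nonneg (mul_nonneg hCL (Real.rpow_nonneg hB₁0 _)) (Real.rpow_nonneg hB₂0 _)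
  calc E ≤ _ := hE
    _ ≤ CL * B₁ ^ (κ₁ + 1) * B₂ ^ κ₂ * (ρ ^ (-(2 * sre + 1)) * dt ^ (2 * sre + 2) * ((1 + lam * x * ρ) * Real.exp (-(c * (lam * x * ρ))))) := by
        refine mul_le_mul_of_nonneg_right (mul_le_mul (mul_le_mul_of_nonneg_left h1 hCL) h2 (Real.rpow_nonneg hB₂0 _)
          (mul_nonneg hCL (Real.rpow_nonneg hB₁0 _))) (mul_nonneg hQ0 hg0)
    _ ≤ CL * B₁ ^ (κ₁ + 1) * B₂ ^ κ₂ * (ρ ^ (-(2 * sre + 1)) * dt ^ (2 * sre + 2) * (max 1 lam * ((1 + x * ρ) ^ (1 : ℝ) * Real.exp (-(c * lam * (x * ρ)))))) :=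
        mul_le_mul_of_nonneg_left (mul_le_mul_of_nonneg_left hg hQ0) hK0
    _ = _ := by ring

/-- **SUM–PRODUCT BOOKKEEPING**: `F i ≤ B`, `E i σ ≤ K·g σ` (all non-negative) ⇒ `Σ_i F i·∏_σ E i σ ≤ (m·B·K^{#S})·∏_σ g σ`. [folklore] -/
theorem sum_mul_prod_le {m : ℕ} {S : Type} [Fintype S] (F : Fin m → ℝ) (E : Fin m → S → ℝ) (good : S → ℝ) {B K : ℝ}
    (hF0 : ∀ i, 0 ≤ F i) (hFB : ∀ i, F i ≤ B) (hE0 : ∀ i σ, 0 ≤ E i σ) (hE : ∀ i σ, E i σ ≤ K * good σ) :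
    ∑ i, F i * ∏ σ, E i σ ≤ ((m : ℝ) * B * K ^ Fintype.card S) * ∏ σ, good σ := by
  have h1 : ∀ i, ∏ σ, E i σ ≤ K ^ Fintype.card S * ∏ σ, good σ := fun i => by
    calc ∏ σ, E i σ ≤ ∏ σ, (K * good σ) := Finset.prod_le_prod (fun σ _ => hE0 i σ) (fun σ _ => hE i σ)
      _ = K ^ Fintype.card S * ∏ σ, good σ := by rw [Finset.prod_mul_distrib, Finset.prod_const, Finset.card_univ]
  calc ∑ i, F i * ∏ σ, E i σ ≤ ∑ _i : Fin m, B * (K ^ Fintype.card S * ∏ σ, good σ) :=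
        Finset.sum_le_sum fun i _ => mul_le_mul (hFB i) (h1 i) (Finset.prod_nonneg fun σ _ => hE0 i σ) ((hF0 i).trans (hFB i))
    _ = ((m : ℝ) * B * K ^ Fintype.card S) * ∏ σ, good σ := by
        rw [Finset.sum_const, Finset.card_univ, Fintype.card_fin, nsmul_eq_mul]
        ring

/-- the exponent window: `dist s z < r` ⇒ `|2re s + 1| ≤ |2re z + 1| + 2r`, `|2re s + 2| ≤ |2re z + 2| + 2r`, and `re s > re z − r`. [folklore] -/
theorem exponent_window {s z : ℂ} {r : ℝ} (hs : dist s z < r) :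
    |2 * s.re + 1| ≤ |2 * z.re + 1| + 2 * r ∧ |2 * s.re + 2| ≤ |2 * z.re + 2| + 2 * r ∧ z.re - r < s.re := by
  have hd : |s.re - z.re| ≤ r := by
    have h := Complex.abs_re_le_norm (s - z)
    rw [Complex.sub_re, ← Complex.dist_eq] at h
    exact h.trans hs.le
  have hlt : |s.re - z.re| < r := by
    have h := Complex.abs_re_le_norm (s - z)
    rw [Complex.sub_re, ← Complex.dist_eq] at h
    exact lt_of_le_of_lt h hs
  refine ⟨?_, ?_, ?_⟩
  · calc |2 * s.re + 1| = |(2 * z.re + 1) + 2 * (s.re - z.re)| := by ring_nf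
      _ ≤ |2 * z.re + 1| + |2 * (s.re - z.re)| := abs_add_le _ _
      _ ≤ |2 * z.re + 1| + 2 * r := by rw [abs_mul, abs_two]; linarith
  · calc |2 * s.re + 2| = |(2 * z.re + 2) + 2 * (s.re - z.re)| := by ring_nf
      _ ≤ |2 * z.re + 2| + |2 * (s.re - z.re)| := abs_add_le _ _
      _ ≤ |2 * z.re + 2| + 2 * r := by rw [abs_mul, abs_two]; linarith
  · have := neg_lt_of_abs_lt hlt
    linarith

/-! ## §2 Frame algebra: the frame reading is multiplicative; a Levi factor multiplies the Iwasawa blocks -/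

/-- `diag(G, G′)·([A, b; 0, d]·κ) = [GA, Gb; 0, G′d]·κ`. [folklore] -/
theorem fromBlocks_diag_mul_blockUpper_mul (G G' A b d : Matrix (Fin 2) (Fin 2) ℂ) (κ : Matrix (Fin 2 ⊕ Fin 2) (Fin 2 ⊕ Fin 2) ℂ) :
    Matrix.fromBlocks G 0 0 G' * (Matrix.fromBlocks A b 0 d * κ) = Matrix.fromBlocks (G * A) (G * b) 0 (G' * d) * κ := by
  rw [← Matrix.mul_assoc, Matrix.fromBlocks_multiply]
  simp

section Frames

variable (L : Type) [Field L] [NumberField L] [IsCMField L] (e : Fin 2 × Fin 1 ≃ Fin 2)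
  (dV : Fin 2 → L) (hdV : ∀ i, IsCMField.complexConj L (dV i) = dV i)
  (dW : Fin 1 → L) (hdW : ∀ i, IsCMField.complexConj L (dW i) = dW i)

/-- **THE FRAME READING IS MULTIPLICATIVE**: `T_σ·((a·q)_∞)_σ·T_σ⁻¹ = (T_σ·(a_∞)_σ·T_σ⁻¹)·(T_σ·(q_∞)_σ·T_σ⁻¹)` (`archPart`, `archAt` are homomorphisms, `T_σ⁻¹T_σ = 1`;
the generic-frame twin of ★ `K2LiuHolTubeRigidityOfFrame.frame_mul`). [cite: BorelJacquet1979, §4.1] -/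
theorem frame_conj_mul (hc : (IsCMField.complexConj L : L ≃ₐ[Fp L] L) ≠ 1) {Sinf : Type} (wp : Sinf → {v : InfinitePlace L // IsComplex v})
    (hwp : ∀ σ, (IsCMField.complexConj L : L ≃ₐ[Fp L] L) • (wp σ).1 = (wp σ).1)
    (er : Fin 2 ⊕ Fin 2 ≃ Fin (2 + 2)) (T Tinv : Sinf → Matrix (Fin 2 ⊕ Fin 2) (Fin 2 ⊕ Fin 2) ℂ) (hT' : ∀ σ, Tinv σ * T σ = 1)
    (a q : HA L e dV hdV dW hdW) (σ : Sinf) :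
    T σ * Matrix.reindex er.symm er.symm
        ((((archAt (Fp L) L (IsCMField.complexConj L : L ≃ₐ[Fp L] L) (2 + 2) (hermD L e dV hdV dW hdW) (wp σ) (hwp σ) hc
            (archPart (Fp L) L (IsCMField.complexConj L : L ≃ₐ[Fp L] L) (2 + 2) (hermD L e dV hdV dW hdW) (a * q)) :
            archLocal L (2 + 2) (hermD L e dV hdV dW hdW) (wp σ)) : GL (Fin (2 + 2)) ℂ) : Matrix (Fin (2 + 2)) (Fin (2 + 2)) ℂ)) * Tinv σ =
      (T σ * Matrix.reindex er.symm er.symm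
        ((((archAt (Fp L) L (IsCMField.complexConj L : L ≃ₐ[Fp L] L) (2 + 2) (hermD L e dV hdV dW hdW) (wp σ) (hwp σ) hc
            (archPart (Fp L) L (IsCMField.complexConj L : L ≃ₐ[Fp L] L) (2 + 2) (hermD L e dV hdV dW hdW) a) :
            archLocal L (2 + 2) (hermD L e dV hdV dW hdW) (wp σ)) : GL (Fin (2 + 2)) ℂ) : Matrix (Fin (2 + 2)) (Fin (2 + 2)) ℂ)) * Tinv σ) *
      (T σ * Matrix.reindex er.symm er.symm
        ((((archAt (Fp L) L (IsCMField.complexConj L : L ≃ₐ[Fp L] L) (2 + 2) (hermD L e dV hdV dW hdW) (wp σ) (hwp σ) hc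
            (archPart (Fp L) L (IsCMField.complexConj L : L ≃ₐ[Fp L] L) (2 + 2) (hermD L e dV hdV dW hdW) q) :
            archLocal L (2 + 2) (hermD L e dV hdV dW hdW) (wp σ)) : GL (Fin (2 + 2)) ℂ) : Matrix (Fin (2 + 2)) (Fin (2 + 2)) ℂ)) * Tinv σ) := by
  have hmul : archPart (Fp L) L (IsCMField.complexConj L : L ≃ₐ[Fp L] L) (2 + 2) (hermD L e dV hdV dW hdW) (a * q) =
      archPart (Fp L) L (IsCMField.complexConj L : L ≃ₐ[Fp L] L) (2 + 2) (hermD L e dV hdV dW hdW) a *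
        archPart (Fp L) L (IsCMField.complexConj L : L ≃ₐ[Fp L] L) (2 + 2) (hermD L e dV hdV dW hdW) q := map_mul _ _ _
  rw [hmul, map_mul, Subgroup.coe_mul, Units.val_mul]
  generalize ((((archAt (Fp L) L (IsCMField.complexConj L : L ≃ₐ[Fp L] L) (2 + 2) (hermD L e dV hdV dW hdW) (wp σ) (hwp σ) hc
      (archPart (Fp L) L (IsCMField.complexConj L : L ≃ₐ[Fp L] L) (2 + 2) (hermD L e dV hdV dW hdW) a) :
      archLocal L (2 + 2) (hermD L e dV hdV dW hdW) (wp σ)) : GL (Fin (2 + 2)) ℂ) : Matrix (Fin (2 + 2)) (Fin (2 + 2)) ℂ)) = X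
  generalize ((((archAt (Fp L) L (IsCMField.complexConj L : L ≃ₐ[Fp L] L) (2 + 2) (hermD L e dV hdV dW hdW) (wp σ) (hwp σ) hc
      (archPart (Fp L) L (IsCMField.complexConj L : L ≃ₐ[Fp L] L) (2 + 2) (hermD L e dV hdV dW hdW) q) :
      archLocal L (2 + 2) (hermD L e dV hdV dW hdW) (wp σ)) : GL (Fin (2 + 2)) ℂ) : Matrix (Fin (2 + 2)) (Fin (2 + 2)) ℂ)) = Y
  have hre : Matrix.reindex er.symm er.symm (X * Y) = Matrix.reindex er.symm er.symm X * Matrix.reindex er.symm er.symm Y := by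
    rw [Matrix.reindex_apply, Matrix.reindex_apply, Matrix.reindex_apply]
    exact (Matrix.submatrix_mul_equiv X Y _ er.symm.symm _).symm
  rw [hre, show T σ * Matrix.reindex er.symm er.symm X * Tinv σ * (T σ * Matrix.reindex er.symm er.symm Y * Tinv σ) =
      T σ * Matrix.reindex er.symm er.symm X * (Tinv σ * T σ) * Matrix.reindex er.symm er.symm Y * Tinv σ by
    simp only [Matrix.mul_assoc], hT', Matrix.mul_one]
  simp only [Matrix.mul_assoc]

end Frames

/-! ## §3 The head: ★ p864699's `hBL₁` from the line's explicit chain, the archimedean factor by name, and the finite-half letter -/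

/-- **(dec-2-pay) THE (β) BLOCK LETTER `hBL₁` OF ★ p864699, ASSEMBLED.**  Socket letters `(L, e, dV, dW)`, the section family `f`, the `B`-line frame
`(eA₀ eB₀ dA₀ dB₀ hVA₀ hVB₀, Λ₀, μ₀, nB₀)` and the row section `γ₀` BY VALUE (★ p864699's bytes); the archimedean frames `(Sinf, wp, hwp, hc, er, T, Tinv, M)` BY VALUE with
the frame letters `hTU` (the frames carry the archimedean components into `U(J)`) and `hLev` (THE LEVI LETTER: `T_σ·(Λ₀γ)_σ·T_σ⁻¹ = diag(σ(γ), G′)` — conjunct (6) `hLevi` of ★ p864905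
`K2LiuKindOneLineLeviFramesOfRecord.exists_leviFrames_of_record`; `hTU` = its conjunct (7) `hTubeF`); a tensor presentation's archimedean letters `(ι, χσ, λ, μf, Finf, Ffin)` with `hsec`
(`IsArchSiegelSection` + scalar `K`-type, per `(i, σ, s)` on `{0 < re s}`), `hline` (the rank-one line letter with rate `π`, locally uniform in `s`), the LINE's EXPLICIT CHAIN
`hchain₁` and the FINITE-HALF letter `hFfin`.  THEN `hBL₁` — ★ p864699 :182–:207 VERBATIM — with `C := m·Cf·(C_L(64M²)^{κ₁+1}(32M²)^{κ₂}max(1,λ))^{#Sinf}`,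
`a := af`, `a₂`, `N₀` from `hFfin`, `κ₁ := |2re z+1|+2r`, `κ₂ := |2re z+2|+2r`, `Ng := 1`, `cπ := λπ∕(64M²)`, `e₁ s := −(2re s+1)`, `e₂ s := 2re s+2`, the
archimedean factor discharged per `σ` by ★ p864675 at `Y := σ(γ̂)·A_σ`.
[cite: KudlaRallis1994, §2 (2.10)–(2.12)] [cite: MoeglinWaldspurger1995, II.1.7, IV.1.9] [cite: Shimura1997, §16, §18.4 Prop. 18.14] [cite: BorelJacquet1979, §1.2, §4.1] -/
theorem blockLetter_rate_of_record
    (L : Type) [Field L] [NumberField L] [IsCMField L] (e : Fin 2 × Fin 1 ≃ Fin 2)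
    (dV : Fin 2 → L) (hdV : ∀ i, IsCMField.complexConj L (dV i) = dV i)
    (dW : Fin 1 → L) (hdW : ∀ i, IsCMField.complexConj L (dW i) = dW i)
    (f : ℂ → HA L e dV hdV dW hdW → ℂ)
    {n₁₀ n₂₀ : ℕ} (eA₀ : Fin 1 × Fin 1 ≃ Fin n₁₀) (eB₀ : Fin 1 × Fin 1 ≃ Fin n₂₀)
    (dA₀ : Fin 1 → L) (hdA₀ : ∀ i, IsCMField.complexConj L (dA₀ i) = dA₀ i)
    (dB₀ : Fin 1 → L) (hdB₀ : ∀ i, IsCMField.complexConj L (dB₀ i) = dB₀ i)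
    (hVA₀ : ∀ i, dV (Fin.castAdd 1 i) = dA₀ i) (hVB₀ : ∀ j, dV (Fin.natAdd 1 j) = dB₀ j)
    [MeasurableSpace (unipDelta L eB₀ dB₀ hdB₀ dW hdW)]
    (Λ₀ : GL (Fin 2) (AdeleRing (𝓞 L) L) →* HA L e dV hdV dW hdW)
    [MeasurableSpace (AdeleRing (𝓞 (Fp L)) (Fp L))]
    (μ₀ : Measure (AdeleRing (𝓞 (Fp L)) (Fp L)))
    (nB₀ : AdeleRing (𝓞 (Fp L)) (Fp L) → unipDelta L eB₀ dB₀ hdB₀ dW hdW)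
    (γ₀ : Projectivization L (Fin 2 → L) → GL (Fin 2) L)
    (hc : (IsCMField.complexConj L : L ≃ₐ[Fp L] L) ≠ 1)
    {Sinf : Type} [Fintype Sinf] (wp : Sinf → {v : InfinitePlace L // IsComplex v})
    (hwp : ∀ σ, (IsCMField.complexConj L : L ≃ₐ[Fp L] L) • (wp σ).1 = (wp σ).1)
    (er : Fin 2 ⊕ Fin 2 ≃ Fin (2 + 2)) (T Tinv : Sinf → Matrix (Fin 2 ⊕ Fin 2) (Fin 2 ⊕ Fin 2) ℂ) (hT' : ∀ σ, Tinv σ * T σ = 1)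
    {M : ℝ} (hM : 1 ≤ M)
    -- THE FRAME LETTERS: `U(J)`-valued frames and the LEVI LETTER (★ `K2LiuKindOneLineLeviFrameDictionary` §3∕§4 at the adapted frames)
    (hTU : ∀ (σ : Sinf) (g : GL (Fin (2 + 2)) ℂ), g ∈ archLocal L (2 + 2) (hermD L e dV hdV dW hdW) (wp σ) →
      (T σ * Matrix.reindex er.symm er.symm (g : Matrix (Fin (2 + 2)) (Fin (2 + 2)) ℂ) * Tinv σ)ᴴ * Matrix.J (Fin 2) ℂ *
        (T σ * Matrix.reindex er.symm er.symm (g : Matrix (Fin (2 + 2)) (Fin (2 + 2)) ℂ) * Tinv σ) = Matrix.J (Fin 2) ℂ)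
    (hLev : ∀ (σ : Sinf) (γ : GL (Fin 2) L), ∃ G' : Matrix (Fin 2) (Fin 2) ℂ, T σ * Matrix.reindex er.symm er.symm
            ((((archAt (Fp L) L (IsCMField.complexConj L : L ≃ₐ[Fp L] L) (2 + 2) (hermD L e dV hdV dW hdW) (wp σ) (hwp σ) hc
                (archPart (Fp L) L (IsCMField.complexConj L : L ≃ₐ[Fp L] L) (2 + 2) (hermD L e dV hdV dW hdW) (Λ₀ (Matrix.GeneralLinearGroup.map (algebraMap L (AdeleRing (𝓞 L) L)) γ))) :
                archLocal L (2 + 2) (hermD L e dV hdV dW hdW) (wp σ)) : GL (Fin (2 + 2)) ℂ) : Matrix (Fin (2 + 2)) (Fin (2 + 2)) ℂ)) * Tinv σ =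
      Matrix.fromBlocks ((γ : Matrix (Fin 2) (Fin 2) L).map (wp σ).1.embedding) 0 0 G')
    -- a tensor presentation's archimedean letters, the LINE's EXPLICIT CHAIN, and the FINITE HALF — BY VALUE
    {m : ℕ} (ι : Matrix (Fin 1 ⊕ Fin 1) (Fin 1 ⊕ Fin 1) ℂ → Matrix (Fin 2 ⊕ Fin 2) (Fin 2 ⊕ Fin 2) ℂ)
    (hι : ∀ x, ι x = Matrix.fromBlocks !![1, 0; 0, x (Sum.inl 0) (Sum.inl 0)] !![0, 0; 0, x (Sum.inl 0) (Sum.inr 0)]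
      !![0, 0; 0, x (Sum.inr 0) (Sum.inl 0)] !![1, 0; 0, x (Sum.inr 0) (Sum.inr 0)])
    (χσ : Sinf → ℂ → ℂ) (hχ1 : ∀ σ, χσ σ 1 = 1) (hχ : ∀ (σ : Sinf) (z : ℂ), z ≠ 0 → ‖χσ σ z‖ ≤ 1)
    {lam : ℝ} (hlam : 0 < lam) (μf : Sinf → L → ℝ)
    (Finf : Fin m → Sinf → ℂ → Matrix (Fin 2 ⊕ Fin 2) (Fin 2 ⊕ Fin 2) ℂ → ℂ) (Ffin : Fin m → L → HA L e dV hdV dW hdW → ℂ → ℂ)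
    (hsec : ∀ (i : Fin m) (σ : Sinf) (s : ℂ), 0 < s.re → IsArchSiegelSection (χσ σ) s (Finf i σ s) ∧
      ∀ k : Matrix (Fin 2 ⊕ Fin 2) (Fin 2 ⊕ Fin 2) ℂ, kᴴ * Matrix.J (Fin 2) ℂ * k = Matrix.J (Fin 2) ℂ →
        moeb k (I • (1 : Matrix (Fin 2) (Fin 2) ℂ)) = I • 1 → ∃ ρ : ℂ, ‖ρ‖ ≤ 1 ∧ ∀ g, Finf i σ s (g * k) = ρ * Finf i σ s g)
    (hline : ∀ z : ℂ, 0 < z.re → ∃ r CL : ℝ, 0 < r ∧ 0 ≤ CL ∧ ∀ (i : Fin m) (σ : Sinf) (s : ℂ), dist s z < r → ∀ hh : ℝ,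
      ‖∫ t : ℝ, Finf i σ s (ι (Matrix.J (Fin 1) ℂ * Matrix.fromBlocks 1 ((t : ℂ) • (1 : Matrix (Fin 1) (Fin 1) ℂ)) 0 1)) * Complex.exp (-(2 * Real.pi * I * hh * t))‖ ≤
        CL * (1 + |hh|) * Real.exp (-(Real.pi * |hh|)))
    (hchain₁ :
            ∀ (S : skewMatrices ((IsCMField.complexConj L : L ≃ₐ[Fp L] L) : L →+* L) ((gramR L e dV hdV dW hdW).map (algebraMap (Fp L) L))) (u w : Fin 2 → L),
        (S : Matrix (Fin 2) (Fin 2) L) = Matrix.vecMulVec u w → u ≠ 0 → ∀ (hw : w ≠ 0) (S' : Matrix (Fin 2) (Fin 2) L),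
        (∀ v : HA L e dV hdV dW hdW, v ∈ unipDelta L e dV hdV dW hdW →
          unipDeltaChar L e dV hdV dW hdW (S : Matrix (Fin 2) (Fin 2) L) ((Λ₀ (Matrix.GeneralLinearGroup.map (algebraMap L (AdeleRing (𝓞 L) L)) (γ₀ (Projectivization.mk L w hw))))⁻¹ * v * Λ₀ (Matrix.GeneralLinearGroup.map (algebraMap L (AdeleRing (𝓞 L) L)) (γ₀ (Projectivization.mk L w hw)))) =
            unipDeltaChar L e dV hdV dW hdW S' v) →
        ∀ D : ℕ, 1 ≤ D → (∀ i j, IsIntegral ℤ ((D : L) * (S : Matrix (Fin 2) (Fin 2) L) i j)) →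
        ∀ (D₀ : Matrix (Fin 2) (Fin 2) L) (σf : L),
        (((γ₀ (Projectivization.mk L w hw) : GL (Fin 2) L) : Matrix (Fin 2) (Fin 2) L).map ((IsCMField.complexConj L : L ≃ₐ[Fp L] L) : L →+* L))ᵀ * (gramR L e dV hdV dW hdW).map (algebraMap (Fp L) L) * D₀ =
            (gramR L e dV hdV dW hdW).map (algebraMap (Fp L) L) →
        D₀ * (S : Matrix (Fin 2) (Fin 2) L) * ((γ₀ (Projectivization.mk L w hw) : GL (Fin 2) L) : Matrix (Fin 2) (Fin 2) L)⁻¹ = Matrix.single 1 1 σf →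
        ∀ s : ℂ, 0 < s.re → ∀ (h : HA L e dV hdV dW hdW),
        (∀ σ : Sinf, |μf σ σf| = lam * (wp σ).1 σf) ∧
                ‖whittakerDelta L eB₀ dB₀ hdB₀ dW hdW (Measure.map nB₀ μ₀)
            ((Matrix.reindex (idxSplit e eA₀ eB₀) (idxSplit e eA₀ eB₀) S').toBlocks₂₂)
            (fun y => f s (blkD L e eA₀ eB₀ dA₀ hdA₀ dB₀ hdB₀ dV hdV hVA₀ hVB₀ dW hdW (1, y) * (Λ₀ (Matrix.GeneralLinearGroup.map (algebraMap L (AdeleRing (𝓞 L) L)) (γ₀ (Projectivization.mk L w hw))) * h))) 1‖ ≤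
          ∑ i : Fin m, ‖Ffin i σf (Λ₀ (Matrix.GeneralLinearGroup.map (algebraMap L (AdeleRing (𝓞 L) L)) (γ₀ (Projectivization.mk L w hw))) * h) s‖ *
            ∏ σ : Sinf, ‖∫ t : ℝ, Finf i σ s (ι (Matrix.J (Fin 1) ℂ * Matrix.fromBlocks 1 ((t : ℂ) • (1 : Matrix (Fin 1) (Fin 1) ℂ)) 0 1) *
          (T σ * Matrix.reindex er.symm er.symm
            ((((archAt (Fp L) L (IsCMField.complexConj L : L ≃ₐ[Fp L] L) (2 + 2) (hermD L e dV hdV dW hdW) (wp σ) (hwp σ) hc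
                (archPart (Fp L) L (IsCMField.complexConj L : L ≃ₐ[Fp L] L) (2 + 2) (hermD L e dV hdV dW hdW) (Λ₀ (Matrix.GeneralLinearGroup.map (algebraMap L (AdeleRing (𝓞 L) L)) (γ₀ (Projectivization.mk L w hw))) * h)) :
                archLocal L (2 + 2) (hermD L e dV hdV dW hdW) (wp σ)) : GL (Fin (2 + 2)) ℂ) : Matrix (Fin (2 + 2)) (Fin (2 + 2)) ℂ)) * Tinv σ)) *
            Complex.exp (-(2 * Real.pi * I * μf σ σf * t))‖)
    (hFfin : ∀ z : ℂ, 0 < z.re → ∃ (r Cf af a₂ : ℝ) (N₀ : ℕ), 0 < r ∧ 0 ≤ Cf ∧ 0 ≤ af ∧ 0 ≤ a₂ ∧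
            ∀ (S : skewMatrices ((IsCMField.complexConj L : L ≃ₐ[Fp L] L) : L →+* L) ((gramR L e dV hdV dW hdW).map (algebraMap (Fp L) L))) (u w : Fin 2 → L),
        (S : Matrix (Fin 2) (Fin 2) L) = Matrix.vecMulVec u w → u ≠ 0 → ∀ (hw : w ≠ 0) (S' : Matrix (Fin 2) (Fin 2) L),
        (∀ v : HA L e dV hdV dW hdW, v ∈ unipDelta L e dV hdV dW hdW →
          unipDeltaChar L e dV hdV dW hdW (S : Matrix (Fin 2) (Fin 2) L) ((Λ₀ (Matrix.GeneralLinearGroup.map (algebraMap L (AdeleRing (𝓞 L) L)) (γ₀ (Projectivization.mk L w hw))))⁻¹ * v * Λ₀ (Matrix.GeneralLinearGroup.map (algebraMap L (AdeleRing (𝓞 L) L)) (γ₀ (Projectivization.mk L w hw)))) =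
            unipDeltaChar L e dV hdV dW hdW S' v) →
        ∀ D : ℕ, 1 ≤ D → (∀ i j, IsIntegral ℤ ((D : L) * (S : Matrix (Fin 2) (Fin 2) L) i j)) →
        ∀ (D₀ : Matrix (Fin 2) (Fin 2) L) (σf : L),
        (((γ₀ (Projectivization.mk L w hw) : GL (Fin 2) L) : Matrix (Fin 2) (Fin 2) L).map ((IsCMField.complexConj L : L ≃ₐ[Fp L] L) : L →+* L))ᵀ * (gramR L e dV hdV dW hdW).map (algebraMap (Fp L) L) * D₀ =
            (gramR L e dV hdV dW hdW).map (algebraMap (Fp L) L) →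
        D₀ * (S : Matrix (Fin 2) (Fin 2) L) * ((γ₀ (Projectivization.mk L w hw) : GL (Fin 2) L) : Matrix (Fin 2) (Fin 2) L)⁻¹ = Matrix.single 1 1 σf →
        ∀ s : ℂ, dist s z < r → ∀ (h : HA L e dV hdV dW hdW) (i : Fin m),
        ‖Ffin i σf (Λ₀ (Matrix.GeneralLinearGroup.map (algebraMap L (AdeleRing (𝓞 L) L)) (γ₀ (Projectivization.mk L w hw))) * h) s‖ ≤
          Cf * adelicHeightGL (2 + 2) L (h : GL (Fin (2 + 2)) (AdeleRing (𝓞 L) L)) ^ af * (D : ℝ) ^ a₂ *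
            (1 + ‖(fun i j => NumberField.mixedEmbedding L ((S : Matrix (Fin 2) (Fin 2) L) i j))‖) ^ N₀) :
    ∀ z : ℂ, 0 < z.re → ∃ (C a a₂ κ₁ κ₂ Ng r cπ : ℝ) (N₀ : ℕ) (e₁ e₂ : ℂ → ℝ),
      0 ≤ C ∧ 0 ≤ a ∧ 0 ≤ a₂ ∧ 0 ≤ Ng ∧ 0 < r ∧ 0 < cπ ∧ (∀ s : ℂ, dist s z < r → |e₁ s| ≤ κ₁ ∧ |e₂ s| ≤ κ₂) ∧
      ∀ (S : skewMatrices ((IsCMField.complexConj L : L ≃ₐ[Fp L] L) : L →+* L) ((gramR L e dV hdV dW hdW).map (algebraMap (Fp L) L))) (u w : Fin 2 → L),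
        (S : Matrix (Fin 2) (Fin 2) L) = Matrix.vecMulVec u w → u ≠ 0 → ∀ (hw : w ≠ 0) (S' : Matrix (Fin 2) (Fin 2) L),
        (∀ v : HA L e dV hdV dW hdW, v ∈ unipDelta L e dV hdV dW hdW →
          unipDeltaChar L e dV hdV dW hdW (S : Matrix (Fin 2) (Fin 2) L) ((Λ₀ (Matrix.GeneralLinearGroup.map (algebraMap L (AdeleRing (𝓞 L) L)) (γ₀ (Projectivization.mk L w hw))))⁻¹ * v * Λ₀ (Matrix.GeneralLinearGroup.map (algebraMap L (AdeleRing (𝓞 L) L)) (γ₀ (Projectivization.mk L w hw)))) =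
            unipDeltaChar L e dV hdV dW hdW S' v) →
        ∀ D : ℕ, 1 ≤ D → (∀ i j, IsIntegral ℤ ((D : L) * (S : Matrix (Fin 2) (Fin 2) L) i j)) →
        ∀ (D₀ : Matrix (Fin 2) (Fin 2) L) (σf : L),
        (((γ₀ (Projectivization.mk L w hw) : GL (Fin 2) L) : Matrix (Fin 2) (Fin 2) L).map ((IsCMField.complexConj L : L ≃ₐ[Fp L] L) : L →+* L))ᵀ * (gramR L e dV hdV dW hdW).map (algebraMap (Fp L) L) * D₀ =
            (gramR L e dV hdV dW hdW).map (algebraMap (Fp L) L) →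
        D₀ * (S : Matrix (Fin 2) (Fin 2) L) * ((γ₀ (Projectivization.mk L w hw) : GL (Fin 2) L) : Matrix (Fin 2) (Fin 2) L)⁻¹ = Matrix.single 1 1 σf →
        ∀ s : ℂ, dist s z < r → ∀ (h : HA L e dV hdV dW hdW) (A b d : Sinf → Matrix (Fin 2) (Fin 2) ℂ) (κ κ' : Sinf → Matrix (Fin 2 ⊕ Fin 2) (Fin 2 ⊕ Fin 2) ℂ),
        (∀ σ, κ σ * κ' σ = 1) → (∀ σ, κ' σ * κ σ = 1) → (∀ σ i j, ‖κ σ i j‖ ≤ M) → (∀ σ i j, ‖κ' σ i j‖ ≤ M) →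
        (∀ σ, T σ * Matrix.reindex er.symm er.symm
            ((((archAt (Fp L) L (IsCMField.complexConj L : L ≃ₐ[Fp L] L) (2 + 2) (hermD L e dV hdV dW hdW) (wp σ) (hwp σ) hc
                (archPart (Fp L) L (IsCMField.complexConj L : L ≃ₐ[Fp L] L) (2 + 2) (hermD L e dV hdV dW hdW) h) :
                archLocal L (2 + 2) (hermD L e dV hdV dW hdW) (wp σ)) : GL (Fin (2 + 2)) ℂ) : Matrix (Fin (2 + 2)) (Fin (2 + 2)) ℂ)) * Tinv σ =
          Matrix.fromBlocks (A σ) (b σ) 0 (d σ) * κ σ) →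
        ‖whittakerDelta L eB₀ dB₀ hdB₀ dW hdW (Measure.map nB₀ μ₀)
            ((Matrix.reindex (idxSplit e eA₀ eB₀) (idxSplit e eA₀ eB₀) S').toBlocks₂₂)
            (fun y => f s (blkD L e eA₀ eB₀ dA₀ hdA₀ dB₀ hdB₀ dV hdV hVA₀ hVB₀ dW hdW (1, y) * (Λ₀ (Matrix.GeneralLinearGroup.map (algebraMap L (AdeleRing (𝓞 L) L)) (γ₀ (Projectivization.mk L w hw))) * h))) 1‖ ≤
          C * adelicHeightGL (2 + 2) L (h : GL (Fin (2 + 2)) (AdeleRing (𝓞 L) L)) ^ a * (D : ℝ) ^ a₂ *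
            (1 + ‖(fun i j => NumberField.mixedEmbedding L ((S : Matrix (Fin 2) (Fin 2) L) i j))‖) ^ N₀ *
            ∏ σ, ((∑ k, ‖(((γ₀ (Projectivization.mk L w hw) : GL (Fin 2) L) : Matrix (Fin 2) (Fin 2) L).map (wp σ).1.embedding * A σ) 1 k‖ ^ 2) ^ e₁ s * ‖(((γ₀ (Projectivization.mk L w hw) : GL (Fin 2) L) : Matrix (Fin 2) (Fin 2) L).map (wp σ).1.embedding * A σ).det‖ ^ e₂ s *
              ((1 + (wp σ).1 σf * (∑ k, ‖(((γ₀ (Projectivization.mk L w hw) : GL (Fin 2) L) : Matrix (Fin 2) (Fin 2) L).map (wp σ).1.embedding * A σ) 1 k‖ ^ 2)) ^ Ng * Real.exp (-(cπ * ((wp σ).1 σf * (∑ k, ‖(((γ₀ (Projectivization.mk L w hw) : GL (Fin 2) L) : Matrix (Fin 2) (Fin 2) L).map (wp σ).1.embedding * A σ) 1 k‖ ^ 2)))))) := by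
  intro z hz
  obtain ⟨r₁, CL, hr₁, hCL, hlin⟩ := hline z hz
  obtain ⟨r₂, Cf, af, a₂, N₀, hr₂, hCf, haf, ha₂, hfin⟩ := hFfin z hz
  have hM0 : 0 ≤ M := zero_le_one.trans hM
  have hM2 : 1 ≤ M ^ 2 := by nlinarith
  have hB₁ : (1 : ℝ) ≤ 64 * M ^ 2 := by nlinarith
  have hB₂ : (1 : ℝ) ≤ 32 * M ^ 2 := by nlinarith
  have hr : 0 < min (min r₁ r₂) z.re := lt_min (lt_min hr₁ hr₂) hz
  have hKσ0 : 0 ≤ CL * (64 * M ^ 2) ^ (|2 * z.re + 1| + 2 * min (min r₁ r₂) z.re + 1) * (32 * M ^ 2) ^ (|2 * z.re + 2| + 2 * min (min r₁ r₂) z.re) * max 1 lam :=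
    mul_nonneg (mul_nonneg (mul_nonneg hCL (Real.rpow_nonneg (by positivity) _)) (Real.rpow_nonneg (by positivity) _)) (le_trans zero_le_one (le_max_left _ _))
  refine ⟨(m : ℝ) * Cf * (CL * (64 * M ^ 2) ^ (|2 * z.re + 1| + 2 * min (min r₁ r₂) z.re + 1) * (32 * M ^ 2) ^ (|2 * z.re + 2| + 2 * min (min r₁ r₂) z.re) *
      max 1 lam) ^ Fintype.card Sinf,
    af, a₂, |2 * z.re + 1| + 2 * min (min r₁ r₂) z.re, |2 * z.re + 2| + 2 * min (min r₁ r₂) z.re, 1, min (min r₁ r₂) z.re,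
    Real.pi / (64 * M ^ 2) * lam, N₀, fun s => -(2 * s.re + 1), fun s => 2 * s.re + 2,
    mul_nonneg (mul_nonneg (Nat.cast_nonneg _) hCf) (pow_nonneg hKσ0 _), haf, ha₂, zero_le_one, hr, by positivity, fun s hs => ?_, ?_⟩
  · beta_reduce
    obtain ⟨h1, h2, -⟩ := exponent_window hs
    exact ⟨by rwa [abs_neg], h2⟩
  intro S u w hS hu hw S' hψ D hD hint D₀ σf hrel hcorner s hs h A b d κ κ' hκκ' hκ'κ hκe hκ'e hdec
  obtain ⟨hκ₁, hκ₂, hsre⟩ := exponent_window hs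
  have hs₀ : 0 < s.re := by
    have : min (min r₁ r₂) z.re ≤ z.re := min_le_right _ _
    linarith
  have hs₁ : dist s z < r₁ := lt_of_lt_of_le hs ((min_le_left _ _).trans (min_le_left _ _))
  have hs₂ : dist s z < r₂ := lt_of_lt_of_le hs ((min_le_left _ _).trans (min_le_right _ _))
  obtain ⟨hμ, hch⟩ := hchain₁ S u w hS hu hw S' hψ D hD hint D₀ σf hrel hcorner s hs₀ h
  choose Gc hGc using hLev
  -- THE POINT IN THE FRAME: Levi letter × Iwasawa blocks of `h`
  have hP : ∀ σ : Sinf, T σ * Matrix.reindex er.symm er.symm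
        ((((archAt (Fp L) L (IsCMField.complexConj L : L ≃ₐ[Fp L] L) (2 + 2) (hermD L e dV hdV dW hdW) (wp σ) (hwp σ) hc
            (archPart (Fp L) L (IsCMField.complexConj L : L ≃ₐ[Fp L] L) (2 + 2) (hermD L e dV hdV dW hdW)
              (Λ₀ (Matrix.GeneralLinearGroup.map (algebraMap L (AdeleRing (𝓞 L) L)) (γ₀ (Projectivization.mk L w hw))) * h)) :
            archLocal L (2 + 2) (hermD L e dV hdV dW hdW) (wp σ)) : GL (Fin (2 + 2)) ℂ) : Matrix (Fin (2 + 2)) (Fin (2 + 2)) ℂ)) * Tinv σ =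
      Matrix.fromBlocks ((((γ₀ (Projectivization.mk L w hw) : GL (Fin 2) L) : Matrix (Fin 2) (Fin 2) L).map (wp σ).1.embedding) * A σ) ((((γ₀ (Projectivization.mk L w hw) : GL (Fin 2) L) : Matrix (Fin 2) (Fin 2) L).map (wp σ).1.embedding) * b σ) 0 (Gc σ (γ₀ (Projectivization.mk L w hw)) * d σ) * κ σ := fun σ => by
    rw [frame_conj_mul L e dV hdV dW hdW hc wp hwp er T Tinv hT' _ _ σ, hGc σ, hdec σ, fromBlocks_diag_mul_blockUpper_mul]
  -- the point is `J`-unitary (the frames carry `U(H_σ)` into `U(J)`)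
  have hPU : ∀ σ : Sinf, (Matrix.fromBlocks ((((γ₀ (Projectivization.mk L w hw) : GL (Fin 2) L) : Matrix (Fin 2) (Fin 2) L).map (wp σ).1.embedding) * A σ) ((((γ₀ (Projectivization.mk L w hw) : GL (Fin 2) L) : Matrix (Fin 2) (Fin 2) L).map (wp σ).1.embedding) * b σ) 0 (Gc σ (γ₀ (Projectivization.mk L w hw)) * d σ) * κ σ)ᴴ * Matrix.J (Fin 2) ℂ *
      (Matrix.fromBlocks ((((γ₀ (Projectivization.mk L w hw) : GL (Fin 2) L) : Matrix (Fin 2) (Fin 2) L).map (wp σ).1.embedding) * A σ) ((((γ₀ (Projectivization.mk L w hw) : GL (Fin 2) L) : Matrix (Fin 2) (Fin 2) L).map (wp σ).1.embedding) * b σ) 0 (Gc σ (γ₀ (Projectivization.mk L w hw)) * d σ) * κ σ) = Matrix.J (Fin 2) ℂ := fun σ => by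
    rw [← hP σ]
    exact hTU σ _ (archAt (Fp L) L (IsCMField.complexConj L : L ≃ₐ[Fp L] L) (2 + 2) (hermD L e dV hdV dW hdW) (wp σ) (hwp σ) hc _).2
  -- the finite half
  have hF := hfin S u w hS hu hw S' hψ D hD hint D₀ σf hrel hcorner s hs₂ h
  -- ASSEMBLY: Σ_i (finite) · ∏_σ (archimedean by ★ p864675, repacked)
  refine hch.trans ?_
  refine (sum_mul_prod_le (fun i : Fin m => ‖Ffin i σf (Λ₀ (Matrix.GeneralLinearGroup.map (algebraMap L (AdeleRing (𝓞 L) L)) (γ₀ (Projectivization.mk L w hw))) * h) s‖)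
    (fun (i : Fin m) (σ : Sinf) => ‖∫ t : ℝ, Finf i σ s (ι (Matrix.J (Fin 1) ℂ * Matrix.fromBlocks 1 ((t : ℂ) • (1 : Matrix (Fin 1) (Fin 1) ℂ)) 0 1) *
          (T σ * Matrix.reindex er.symm er.symm
            ((((archAt (Fp L) L (IsCMField.complexConj L : L ≃ₐ[Fp L] L) (2 + 2) (hermD L e dV hdV dW hdW) (wp σ) (hwp σ) hc
                (archPart (Fp L) L (IsCMField.complexConj L : L ≃ₐ[Fp L] L) (2 + 2) (hermD L e dV hdV dW hdW) (Λ₀ (Matrix.GeneralLinearGroup.map (algebraMap L (AdeleRing (𝓞 L) L)) (γ₀ (Projectivization.mk L w hw))) * h)) :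
                archLocal L (2 + 2) (hermD L e dV hdV dW hdW) (wp σ)) : GL (Fin (2 + 2)) ℂ) : Matrix (Fin (2 + 2)) (Fin (2 + 2)) ℂ)) * Tinv σ)) *
            Complex.exp (-(2 * Real.pi * I * μf σ σf * t))‖)
    (fun σ : Sinf => (∑ k, ‖((((γ₀ (Projectivization.mk L w hw) : GL (Fin 2) L) : Matrix (Fin 2) (Fin 2) L).map (wp σ).1.embedding) * A σ) 1 k‖ ^ 2) ^ (-(2 * s.re + 1)) * ‖((((γ₀ (Projectivization.mk L w hw) : GL (Fin 2) L) : Matrix (Fin 2) (Fin 2) L).map (wp σ).1.embedding) * A σ).det‖ ^ (2 * s.re + 2) *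
      ((1 + (wp σ).1 σf * (∑ k, ‖((((γ₀ (Projectivization.mk L w hw) : GL (Fin 2) L) : Matrix (Fin 2) (Fin 2) L).map (wp σ).1.embedding) * A σ) 1 k‖ ^ 2)) ^ (1 : ℝ) * Real.exp (-(Real.pi / (64 * M ^ 2) * lam * ((wp σ).1 σf * (∑ k, ‖((((γ₀ (Projectivization.mk L w hw) : GL (Fin 2) L) : Matrix (Fin 2) (Fin 2) L).map (wp σ).1.embedding) * A σ) 1 k‖ ^ 2))))))
    (K := CL * (64 * M ^ 2) ^ (|2 * z.re + 1| + 2 * min (min r₁ r₂) z.re + 1) * (32 * M ^ 2) ^ (|2 * z.re + 2| + 2 * min (min r₁ r₂) z.re) * max 1 lam)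
    (fun i => norm_nonneg _) hF (fun i σ => norm_nonneg _) (fun i σ => ?_)).trans (le_of_eq ?_)
  · -- per place: ★ p864675 at `Y := σ(γ̂)·A_σ`, movers `κ_σ κ′_σ`, read back on the frame point, then repacked
    obtain ⟨hf, hK⟩ := hsec i σ s hs₀
    have h675 := norm_corner_lineWhittaker_le_of_boundedMovers ι hι hf (hχ1 σ) (hχ σ) hK hCL (hlin i σ s hs₁) hM (hPU σ) (hκκ' σ) (hκe σ) (hκ'e σ) (μf σ σf)
    rw [← hP σ, hμ σ] at h675
    exact perPlace_repack hCL hB₁ hB₂ (Finset.sum_nonneg fun _ _ => sq_nonneg _) (norm_nonneg _) (apply_nonneg _ _) hlam hκ₁ hκ₂ h675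
  · beta_reduce
    ring

end Summit.HodgeConjecture.HodgeConjecture.Cruxes.HLiu418.K2LiuKindOneLineBlockLetterOfRecord

end
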